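import Summits.KontsevichZagierPeriods.KontsevichZagierPeriods.Theses.ToricCore
import Literature.NumberTheory.Transcendental.KZToricCalculus

/-!
# Toric cells inside the unit cube — tools for route ToricCore (support of `TornheimToric`,
stmt-KontsevichZagierPeriods-7838)

Bookkeeping for the "toric as data" clauses of the toric sub-calculus `R_tor = KZ.toricRelations`
(generated by the toric instances of the KZ moves (1a), (1b), (3) and the integer monomial changes
of variables between representations of the toric span `T = KZ.toricSpan`):

* signed binomials: monomials `xᵃ`, `1 − xᵃ`; every signed binomial is a polynomial
  function with rational coefficients, so a **toric cell**
  `{x | ∀ k, 0 < g_k x} ∩ {x | ∀ k, 0 ≤ h_k x}` is `ℚ`-semialgebraic (`isSemialgebraic_cell`);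
* the cube cells `□ⁿ ∩ cell(g, h)`: as ONE toric cell (the `2n` cube inequalities `xᵢ > 0`,
  `1 − xᵢ > 0` concatenated with `g` through `Fintype.equivFin`), hence semialgebraic
  (`isSemialgebraic_cube_inter`), and a representation on such a cell with integrand `P / ∏ d_k`
  there is toric (`isToric_of_cell`);
* the two ways the move (1a) is used inside `R_tor`: a domain-additivity instance among toric
  representations is a toric relation (`domainAdd_mem_toricRelations`), and a toric representation
  on a NULL cell is a toric relation by the instance `σ = σ ∪ σ` (`of_mem_toricRelations_of_volume_eq_zero`);
  coordinate hyperplanes `{xᵢ = xⱼ}` are null (`volume_setOf_apply_eq_apply`);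
* the six signed binomials of `ℝ³` entering Tornheim's chain (`x₁ − x₀`, `x₀ − x₁`, `1 − x₀x₂`,
  `1 − x₁x₂`, `1 − x₀x₁`, `1 − x₀x₁x₂`).

References: M. Kontsevich, D. Zagier, *Periods* (2001), §1.2; L. Guo, S. Paycha, B. Zhang,
*Conical zeta values and their double subdivision relations*, Adv. Math. 252 (2014), §2.
-/

open Set MeasureTheory MvPolynomial
open Literature.NumberTheory.Transcendental
open Literature.ModelTheory.ExponentialFields (IsSemialgebraic isSemialgebraic_setOf_eval_pos
  isSemialgebraic_setOf_eval_nonneg)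

namespace Summit.KontsevichZagierPeriods.ToricCore

variable {n : ℕ}

/-! ### Signed binomials -/

/-- A monomial `x ↦ ∏ᵢ xᵢ^{aᵢ}` is a signed binomial (`1 · xᵃ + 0`). [folklore] -/
theorem isSignedBinomial_monomial (a : Fin n → ℕ) :
    KZ.IsSignedBinomial (fun x : Fin n → ℝ => ∏ i, x i ^ a i) :=
  ⟨1, 0, a, 0, funext fun x => by simp⟩

/-- `x ↦ 1 − ∏ᵢ xᵢ^{aᵢ}` is a signed binomial (`1 · x⁰ + (−1) · xᵃ`). [folklore] -/
theorem isSignedBinomial_one_sub_monomial (a : Fin n → ℕ) :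
    KZ.IsSignedBinomial (fun x : Fin n → ℝ => 1 - ∏ i, x i ^ a i) :=
  ⟨1, -1, 0, a, funext fun x => by simp [sub_eq_add_neg]⟩

/-- **A signed binomial is a polynomial function with rational coefficients.** [folklore] -/
theorem exists_aeval_eq_of_isSignedBinomial {f : (Fin n → ℝ) → ℝ} (hf : KZ.IsSignedBinomial f) :
    ∃ P : MvPolynomial (Fin n) ℚ, ∀ x, f x = aeval x P := by
  obtain ⟨u, w, a, b, rfl⟩ := hf
  have hc : ∀ s : SignType, algebraMap ℚ ℝ (s : ℚ) = (s : ℝ) := fun s => by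
    rcases s <;> simp
  refine ⟨C ((u : ℚ)) * ∏ i, X i ^ a i + C ((w : ℚ)) * ∏ i, X i ^ b i, fun x => ?_⟩
  simp only [map_add, map_mul, map_prod, map_pow, aeval_X, aeval_C, hc]

/-! ### Toric cells are semialgebraic -/

/-- **A toric cell is `ℚ`-semialgebraic**: `{x | ∀ k, 0 < g_k x} ∩ {x | ∀ k, 0 ≤ h_k x}` for
signed binomials `g_k`, `h_k` is a finite intersection of polynomial sign conditions over `ℚ`.
[cite: BochnakCosteRoy1998, Def. 2.1.4] -/
theorem isSemialgebraic_cell {N M : ℕ} (g : Fin N → (Fin n → ℝ) → ℝ)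
    (h : Fin M → (Fin n → ℝ) → ℝ) (hg : ∀ k, KZ.IsSignedBinomial (g k))
    (hh : ∀ k, KZ.IsSignedBinomial (h k)) :
    IsSemialgebraic ℚ {x | (∀ k, 0 < g k x) ∧ ∀ k, 0 ≤ h k x} := by
  choose P hP using fun k => exists_aeval_eq_of_isSignedBinomial (hg k)
  choose Q hQ using fun k => exists_aeval_eq_of_isSignedBinomial (hh k)
  have hset : {x | (∀ k, 0 < g k x) ∧ ∀ k, 0 ≤ h k x} =
      (⋂ k ∈ (Finset.univ : Finset (Fin N)), {x | 0 < aeval x (P k)}) ∩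
        ⋂ k ∈ (Finset.univ : Finset (Fin M)), {x | 0 ≤ aeval x (Q k)} := by
    ext x
    simp [hP, hQ]
  rw [hset]
  exact (IsSemialgebraic.biInter _ _ fun k _ => isSemialgebraic_setOf_eval_pos _).inter
    (IsSemialgebraic.biInter _ _ fun k _ => isSemialgebraic_setOf_eval_nonneg _)

/-! ### Cube cells -/

/-- The cube cell `□ⁿ ∩ cell(g, h)` as ONE toric cell: the `2n` cube inequalities `xᵢ > 0`,
`1 − xᵢ > 0` are concatenated with the family `g` through `Fintype.equivFin`. [folklore] -/
theorem cube_inter_cell_eq {N M : ℕ} (g : Fin N → (Fin n → ℝ) → ℝ) (h : Fin M → (Fin n → ℝ) → ℝ) :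
    {x : Fin n → ℝ | (∀ i, 0 < x i ∧ x i < 1) ∧ (∀ k, 0 < g k x) ∧ ∀ k, 0 ≤ h k x} =
      {x | (∀ k, 0 < Sum.elim (Sum.elim (fun (i : Fin n) (x : Fin n → ℝ) => x i) (fun i x => 1 - x i))
          g ((Fintype.equivFin ((Fin n ⊕ Fin n) ⊕ Fin N)).symm k) x) ∧ ∀ k, 0 ≤ h k x} := by
  ext x
  simp only [mem_setOf_eq]
  constructor
  · rintro ⟨hx, hgx, hhx⟩
    refine ⟨fun k => ?_, hhx⟩
    generalize (Fintype.equivFin ((Fin n ⊕ Fin n) ⊕ Fin N)).symm k = j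
    rcases j with (i | i) | k
    · exact (hx i).1
    · exact sub_pos.mpr (hx i).2
    · exact hgx k
  · rintro ⟨hG, hhx⟩
    refine ⟨fun i => ⟨?_, ?_⟩, fun k => ?_, hhx⟩
    · have h1 := hG (Fintype.equivFin ((Fin n ⊕ Fin n) ⊕ Fin N) (Sum.inl (Sum.inl i)))
      rwa [Equiv.symm_apply_apply] at h1
    · have h1 := hG (Fintype.equivFin ((Fin n ⊕ Fin n) ⊕ Fin N) (Sum.inl (Sum.inr i)))
      rw [Equiv.symm_apply_apply] at h1
      exact sub_pos.mp h1
    · have h1 := hG (Fintype.equivFin ((Fin n ⊕ Fin n) ⊕ Fin N) (Sum.inr k))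
      rwa [Equiv.symm_apply_apply] at h1

/-- Every member of the concatenated family (cube inequalities, then `g`) is a signed binomial
when the `g_k` are. [folklore] -/
theorem isSignedBinomial_cubeFamily {N : ℕ} (g : Fin N → (Fin n → ℝ) → ℝ)
    (hg : ∀ k, KZ.IsSignedBinomial (g k)) (k : Fin (Fintype.card ((Fin n ⊕ Fin n) ⊕ Fin N))) :
    KZ.IsSignedBinomial (Sum.elim (Sum.elim (fun (i : Fin n) (x : Fin n → ℝ) => x i)
      (fun i x => 1 - x i)) g ((Fintype.equivFin ((Fin n ⊕ Fin n) ⊕ Fin N)).symm k)) := by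
  generalize (Fintype.equivFin ((Fin n ⊕ Fin n) ⊕ Fin N)).symm k = j
  rcases j with (i | i) | k
  · -- `x ↦ xᵢ` is the monomial `x^{eᵢ}`
    have h := isSignedBinomial_monomial (n := n) (Pi.single i 1)
    have he : (fun x : Fin n → ℝ => ∏ l, x l ^ (Pi.single i 1 : Fin n → ℕ) l) = fun x => x i := by
      funext x
      rw [Finset.prod_eq_single i (fun l _ hl => by simp [hl]) (fun h => absurd (Finset.mem_univ i) h)]
      simp
    rwa [he] at h
  · have h := isSignedBinomial_one_sub_monomial (n := n) (Pi.single i 1)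
    have he : (fun x : Fin n → ℝ => 1 - ∏ l, x l ^ (Pi.single i 1 : Fin n → ℕ) l) =
        fun x => 1 - x i := by
      funext x
      rw [Finset.prod_eq_single i (fun l _ hl => by simp [hl]) (fun h => absurd (Finset.mem_univ i) h)]
      simp
    rwa [he] at h
  · exact hg k

/-- **A cube cell is `ℚ`-semialgebraic.** [cite: BochnakCosteRoy1998, Def. 2.1.4] -/
theorem isSemialgebraic_cube_inter {N M : ℕ} (g : Fin N → (Fin n → ℝ) → ℝ)
    (h : Fin M → (Fin n → ℝ) → ℝ) (hg : ∀ k, KZ.IsSignedBinomial (g k))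
    (hh : ∀ k, KZ.IsSignedBinomial (h k)) :
    IsSemialgebraic ℚ {x : Fin n → ℝ | (∀ i, 0 < x i ∧ x i < 1) ∧ (∀ k, 0 < g k x) ∧ ∀ k, 0 ≤ h k x} := by
  rw [cube_inter_cell_eq]
  exact isSemialgebraic_cell _ _ (isSignedBinomial_cubeFamily g hg) hh

/-- **A representation on a cube cell with integrand `P / ∏ d_k` is toric.** If
`r.domain = □ⁿ ∩ cell(g, h)` for signed binomials `g_k`, `h_k` and `r.integrand = P / ∏ d_k` there
(`P ∈ ℚ[x]`, `d_k` signed binomials), then `r` is toric (so `[r] ∈ T`, `KZ.of_mem_toricSpan`).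
[cite: GuoPaychaZhang2014, §2] -/
theorem isToric_of_cell {N M K : ℕ} (r : KZ.IntegralRep n) (g : Fin N → (Fin n → ℝ) → ℝ)
    (h : Fin M → (Fin n → ℝ) → ℝ) (d : Fin K → (Fin n → ℝ) → ℝ) (P : MvPolynomial (Fin n) ℚ)
    (hg : ∀ k, KZ.IsSignedBinomial (g k)) (hh : ∀ k, KZ.IsSignedBinomial (h k))
    (hd : ∀ k, KZ.IsSignedBinomial (d k))
    (hdom : r.domain = {x | (∀ i, 0 < x i ∧ x i < 1) ∧ (∀ k, 0 < g k x) ∧ ∀ k, 0 ≤ h k x})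
    (hint : EqOn r.integrand (fun x => aeval x P / ∏ k, d k x) r.domain) : KZ.IsToric r := by
  refine ⟨_, M, K, _, h, d, P, ?_, by rw [hdom, cube_inter_cell_eq], hint⟩
  rintro f ((⟨k, rfl⟩ | ⟨k, rfl⟩) | ⟨k, rfl⟩)
  · exact isSignedBinomial_cubeFamily g hg k
  · exact hh k
  · exact hd k

/-! ### The move (1a) inside the toric sub-calculus -/

/-- **Domain additivity inside `R_tor`.** An instance `[r] − [r₁] − [r₂]` of the move (1a)
(`σ = σ₁ ∪ σ₂`, `σ₁ ∩ σ₂` null, integrands agreeing) among representations of the toric span is a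
toric relation: it lies in `domainAddRel ∩ T`. [cite: KontsevichZagier2001, §1.2 rule (1)] -/
theorem domainAdd_mem_toricRelations {r r₁ r₂ : KZ.IntegralRep n} (hr : KZ.of r ∈ KZ.toricSpan)
    (hr₁ : KZ.of r₁ ∈ KZ.toricSpan) (hr₂ : KZ.of r₂ ∈ KZ.toricSpan)
    (hdom : r.domain = r₁.domain ∪ r₂.domain) (hnull : volume (r₁.domain ∩ r₂.domain) = 0)
    (h₁ : EqOn r.integrand r₁.integrand r₁.domain) (h₂ : EqOn r.integrand r₂.integrand r₂.domain) :
    KZ.of r - KZ.of r₁ - KZ.of r₂ ∈ KZ.toricRelations :=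
  KZ.inter_toricSpan_subset_toricRelations
    ⟨Or.inl (Or.inl ⟨n, r, r₁, r₂, hdom, hnull, h₁, h₂, rfl⟩),
      KZ.toricSpan.sub_mem (KZ.toricSpan.sub_mem hr hr₁) hr₂⟩

/-- **Null toric cells are toric relations.** A representation of the toric span whose domain is
Lebesgue-null is a toric relation, by the instance `σ = σ ∪ σ` of the move (1a):
`[r] − [r] − [r] = −[r] ∈ domainAddRel ∩ T`. [cite: KontsevichZagier2001, §1.2 rule (1)] -/
theorem of_mem_toricRelations_of_volume_eq_zero {r : KZ.IntegralRep n} (hr : KZ.of r ∈ KZ.toricSpan)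
    (hnull : volume r.domain = 0) : KZ.of r ∈ KZ.toricRelations := by
  have h := domainAdd_mem_toricRelations hr hr hr (Set.union_self _).symm
    (by rwa [Set.inter_self]) (fun _ _ => rfl) (fun _ _ => rfl)
  have he : KZ.of r - KZ.of r - KZ.of r = -KZ.of r := by abel
  rw [he] at h
  exact neg_mem_iff.mp h

/-- **Coordinate hyperplanes are null**: `{x | xᵢ = xⱼ}` (`i ≠ j`) has Lebesgue measure `0` in
`ℝⁿ` (a strict linear subspace, `Measure.addHaar_submodule`). [folklore] -/
theorem volume_setOf_apply_eq_apply (i j : Fin n) (hij : i ≠ j) :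
    volume {x : Fin n → ℝ | x i = x j} = 0 := by
  let L : (Fin n → ℝ) →ₗ[ℝ] ℝ :=
    LinearMap.proj (R := ℝ) (φ := fun _ : Fin n => ℝ) i - LinearMap.proj (R := ℝ) (φ := fun _ : Fin n => ℝ) j
  have hker : ((LinearMap.ker L : Submodule ℝ (Fin n → ℝ)) : Set (Fin n → ℝ)) = {x | x i = x j} := by
    ext x
    simp [L, sub_eq_zero]
  have hne : LinearMap.ker L ≠ ⊤ := by
    intro htop
    have hx : (Pi.single i (1 : ℝ) : Fin n → ℝ) ∈ LinearMap.ker L := htop ▸ Submodule.mem_top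
    rw [LinearMap.mem_ker] at hx
    simp [L, hij.symm] at hx
  rw [← hker]
  exact Measure.addHaar_submodule volume _ hne

/-! ### Signed binomials in dimension three -/

/-- Constructor: a function given pointwise by `u xᵃ + w xᵇ` is a signed binomial. [folklore] -/
theorem isSignedBinomial_of_forall {n : ℕ} {f : (Fin n → ℝ) → ℝ} (u w : SignType) (a b : Fin n → ℕ)
    (h : ∀ x, f x = (u : ℝ) * (∏ i, x i ^ a i) + (w : ℝ) * (∏ i, x i ^ b i)) :
    KZ.IsSignedBinomial f :=
  ⟨u, w, a, b, funext h⟩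

/-- `x₁ − x₀` is a signed binomial on `ℝ³`. [folklore] -/
theorem isSignedBinomial_x1_sub_x0 : KZ.IsSignedBinomial (fun x : Fin 3 → ℝ => x 1 - x 0) :=
  isSignedBinomial_of_forall 1 (-1) ![0, 1, 0] ![1, 0, 0] fun x => by
    simp [Fin.prod_univ_three, sub_eq_add_neg]

/-- `x₀ − x₁` is a signed binomial on `ℝ³`. [folklore] -/
theorem isSignedBinomial_x0_sub_x1 : KZ.IsSignedBinomial (fun x : Fin 3 → ℝ => x 0 - x 1) :=
  isSignedBinomial_of_forall 1 (-1) ![1, 0, 0] ![0, 1, 0] fun x => by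
    simp [Fin.prod_univ_three, sub_eq_add_neg]

/-- `1 − xᵢxⱼ` (`(i,j) = (0,2)`) is a signed binomial on `ℝ³`. [folklore] -/
theorem isSignedBinomial_one_sub_x0x2 :
    KZ.IsSignedBinomial (fun x : Fin 3 → ℝ => 1 - x 0 * x 2) :=
  isSignedBinomial_of_forall 1 (-1) 0 ![1, 0, 1] fun x => by
    simp [Fin.prod_univ_three, sub_eq_add_neg]

/-- `1 − x₁x₂` is a signed binomial on `ℝ³`. [folklore] -/
theorem isSignedBinomial_one_sub_x1x2 :
    KZ.IsSignedBinomial (fun x : Fin 3 → ℝ => 1 - x 1 * x 2) :=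
  isSignedBinomial_of_forall 1 (-1) 0 ![0, 1, 1] fun x => by
    simp [Fin.prod_univ_three, sub_eq_add_neg]

/-- `1 − x₀x₁` is a signed binomial on `ℝ³`. [folklore] -/
theorem isSignedBinomial_one_sub_x0x1 :
    KZ.IsSignedBinomial (fun x : Fin 3 → ℝ => 1 - x 0 * x 1) :=
  isSignedBinomial_of_forall 1 (-1) 0 ![1, 1, 0] fun x => by
    simp [Fin.prod_univ_three, sub_eq_add_neg]

/-- `1 − x₀x₁x₂` is a signed binomial on `ℝ³`. [folklore] -/
theorem isSignedBinomial_one_sub_x0x1x2 :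
    KZ.IsSignedBinomial (fun x : Fin 3 → ℝ => 1 - x 0 * x 1 * x 2) :=
  isSignedBinomial_of_forall 1 (-1) 0 ![1, 1, 1] fun x => by
    simp [Fin.prod_univ_three, sub_eq_add_neg]

end Summit.KontsevichZagierPeriods.ToricCore
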